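import Summits.ABC.ABC.Theses.IneffectiveSubspace

/-!
# `UniformSadicTowerFour` (stmt-ABC-14937), line `Sketch`: the elementary corner `ω(abc) ≤ 2`

The stub `stub_omegaCounted_two` of the line `Sketch` (card `mixed-radical-exchange-map`).

**Statement.** For every `ε > 0` there is `C > 0` (in fact `C = 2` serves for every `ε`) such
that every abc triple `(a, b, c)` (`0 < a`, `0 < b`, `a + b = c`, `Coprime a b`) whose product
`abc` has at most two distinct prime factors satisfies `c < C · rad(abc)^(1+ε)`.

**Proof (classification of the cell `ω(abc) ≤ 2`).** The triple is pairwise coprime, so if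
`a, b ≥ 2` then `a, b, c` carry three distinct primes; hence `a = 1` or `b = 1`, and `abc = n(n+1)`
with `c = n + 1`. If `n = 1` then `c = 2 = rad`. If `n ≥ 2`, the coprime numbers `n, n + 1` have one
prime factor each, so `n = p^i`, `n + 1 = q^j` are prime powers, `rad(abc) = pq`, and one of `p, q`
is `2` (one of two consecutive numbers is even). Two classical exponential facts finish the proof:
* (A) `q^m + 1 = 2^l` with `q ≥ 3` odd forces `m ≤ 1`: for `m` even `q^m + 1 ≡ 2 (mod 4)`; for `m`
  odd, `q + 1 = 2^t` divides `q^m + 1`, and `q² ≡ 1 (mod 2^(t+1))` gives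
  `q^m + 1 ≡ q + 1 = 2^t (mod 2^(t+1))`, incompatible with `2^(t+1) ∣ 2^l = q^m + 1`;
* (B) `2^i + 1 = q^j` with `q ≥ 3` odd forces `j ≤ 1` or `(q, j) = (3, 2)` (`8 + 1 = 9`): for `j`
  even, `(q^k + 1)(q^k - 1) = 2^i` is a product of two powers of two differing by `2`, so `q^k = 3`;
  for `j` odd, `q - 1 = 2^t` divides `q^j - 1` and `q² ≡ 1 (mod 2^(t+1))` gives
  `q^j - 1 ≡ q - 1 = 2^t (mod 2^(t+1))`, incompatible with `2^(t+1) ∣ 2^i = q^j - 1`.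
So the cell consists of `1 + 1 = 2`, `(1, q, q + 1 = 2^j)`, `(1, 2^i, 2^i + 1 = q)` (`q` prime)
and `1 + 8 = 9`, up to swapping `a, b`; in each case `c < 2 · rad(abc) ≤ 2 · rad(abc)^(1+ε)`
(`rad ≥ 1`).

Sources: card mixed-radical-exchange-map (crux stmt-ABC-14937, line Sketch); the Catalan-type facts
`2^l ± 1 = q^m` are classical (Gersonides/Levi ben Gershon 1343 for `{2, 3}`; elementary). Mathlib
only (`Nat.primeFactors_mul`, `isPrimePow_iff_card_primeFactors_eq_one`,
`UniqueFactorizationMonoid.radical_mul`, `Nat.sq_sub_sq`, `Odd.nat_add_dvd_pow_add_pow`,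
`Nat.sub_one_dvd_pow_sub_one`, `Nat.ModEq`). Deliberately NOT here: the other stubs of the line.
-/

-- `Summit.<Summit>.<Problem>` is the mandated summit-side namespace (CONVENTIONS §2); for the
-- single-conjunct summit `ABC` the two coincide, so the duplicate `ABC.ABC` is deliberate.
set_option linter.dupNamespace false

namespace Summit.ABC.ABC.Theorems.UniformSadicTowerFour.MixedRadical

open Literature.NumberTheory.DiophantineGeometry (IsABCTriple rad rad_def)
open Summit.ABC.ABC.Theses.IneffectiveSubspace
open scoped BigOperators
open UniqueFactorizationMonoid (radical)

/-! ## Two exponential Diophantine facts at the prime `2` -/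

/-- **Odd powers modulo a divisor of `q² - 1`.** If `q² ≡ 1 (mod n)` then `q^(2k+1) ≡ q (mod n)`.
[folklore] -/
theorem omegaTwo_pow_odd_modEq {q n k : ℕ} (h : q ^ 2 ≡ 1 [MOD n]) :
    q ^ (2 * k + 1) ≡ q [MOD n] := by
  have := (h.pow k).mul_right q
  rwa [one_pow, one_mul, ← pow_mul, ← pow_succ] at this

/-- **`q² ≡ 1 (mod 2^(t+1))`** as soon as `2^(t+1) ∣ (q + 1)(q - 1)` and `q ≥ 1`. [folklore] -/
theorem omegaTwo_sq_modEq {q t : ℕ} (hq : 0 < q) (h : 2 ^ (t + 1) ∣ (q + 1) * (q - 1)) :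
    q ^ 2 ≡ 1 [MOD 2 ^ (t + 1)] := by
  refine ((Nat.modEq_iff_dvd' (Nat.one_le_pow _ _ hq)).2 ?_).symm
  have hsq := Nat.sq_sub_sq q 1
  rw [one_pow] at hsq
  rwa [hsq]

/-- **(A) `q^m + 1 = 2^l` with `q ≥ 3` odd forces `m ≤ 1`** (Gersonides-type: for `m` even
`q^m + 1 ≡ 2 (mod 4)`; for `m` odd lift along `q + 1 = 2^t`). [folklore] -/
theorem omegaTwo_pow_add_one_eq_two_pow {q m l : ℕ} (hq : Odd q) (h3 : 3 ≤ q)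
    (h : q ^ m + 1 = 2 ^ l) : m ≤ 1 := by
  by_contra hm
  replace hm : 1 < m := not_le.1 hm
  have hql : q < q ^ m :=
    calc q = q ^ 1 := (pow_one q).symm
      _ < q ^ m := Nat.pow_lt_pow_right (by omega) hm
  rcases Nat.even_or_odd m with ⟨k, hk⟩ | ⟨k, hk⟩
  · -- even exponent: `q ^ m` is an odd square, `≡ 1 (mod 4)`, while `4 ∣ 2 ^ l`
    have h4 : 4 ∣ 2 ^ l := by
      have h2l : 2 ^ 2 < 2 ^ l := by rw [← h]; omega
      simpa using Nat.pow_dvd_pow 2 ((Nat.pow_lt_pow_iff_right (by norm_num)).1 h2l).le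
    obtain ⟨r, hr⟩ : Odd (q ^ k) := hq.pow
    obtain ⟨s, hs⟩ : ∃ s, q ^ m = 4 * s + 1 := ⟨r * r + r, by rw [hk, pow_add, hr]; ring⟩
    omega
  · -- odd exponent `m = 2k + 1`, `k ≥ 1`: lift along `q + 1 = 2 ^ t`
    obtain ⟨t, -, ht⟩ : ∃ t ≤ l, q + 1 = 2 ^ t := by
      refine (Nat.dvd_prime_pow Nat.prime_two).1 ?_
      rw [← h, hk]
      simpa only [one_pow] using (odd_two_mul_add_one k).nat_add_dvd_pow_add_pow q 1
    have hsq : q ^ 2 ≡ 1 [MOD 2 ^ (t + 1)] := by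
      refine omegaTwo_sq_modEq (by omega) ?_
      rw [pow_succ, ht]
      exact mul_dvd_mul_left _ (hq.tsub_odd odd_one).two_dvd
    have hmod : q ^ m + 1 ≡ q + 1 [MOD 2 ^ (t + 1)] := by
      rw [hk]
      exact (omegaTwo_pow_odd_modEq hsq).add_right 1
    have htl : t < l := by
      have : 2 ^ t < 2 ^ l := by rw [← ht, ← h]; omega
      exact (Nat.pow_lt_pow_iff_right (by norm_num)).1 this
    have hdvd : 2 ^ (t + 1) ∣ q ^ m + 1 := by
      rw [h]
      exact Nat.pow_dvd_pow 2 htl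
    have htt : 2 ^ (t + 1) ∣ 2 ^ t := by
      rw [← ht]
      exact Nat.modEq_zero_iff_dvd.1 ((Nat.modEq_zero_iff_dvd.2 hdvd).symm.trans hmod).symm
    have := (Nat.pow_dvd_pow_iff_le_right (by norm_num)).1 htt
    omega

/-- **(B) `2^i + 1 = q^j` with `q ≥ 3` odd forces `j ≤ 1` or `(q, j) = (3, 2)`** (Gersonides-type:
for `j` even `(q^k + 1)(q^k - 1) = 2^i`; for `j` odd lift along `q - 1 = 2^t`). [folklore] -/
theorem omegaTwo_two_pow_add_one_eq_pow {q j i : ℕ} (hq : Odd q) (h3 : 3 ≤ q)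
    (h : 2 ^ i + 1 = q ^ j) : j ≤ 1 ∨ (q = 3 ∧ j = 2) := by
  rcases Nat.lt_or_ge 1 j with hj | hj
  swap
  · exact Or.inl hj
  right
  have hql : q < q ^ j :=
    calc q = q ^ 1 := (pow_one q).symm
      _ < q ^ j := Nat.pow_lt_pow_right (by omega) hj
  have h4 : ∀ e, 2 ≤ e → 4 ∣ 2 ^ e := fun e he => by simpa using Nat.pow_dvd_pow 2 he
  rcases Nat.even_or_odd j with ⟨k, hk⟩ | ⟨k, hk⟩
  · -- even exponent `j = 2k`: `(q^k + 1)(q^k - 1) = 2^i`, two powers of two differing by `2`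
    have hx3 : 3 ≤ q ^ k :=
      calc 3 ≤ q := h3
        _ = q ^ 1 := (pow_one q).symm
        _ ≤ q ^ k := Nat.pow_le_pow_right (by omega) (by omega)
    have hkk : q ^ j = (q ^ k) ^ 2 := by rw [hk, ← two_mul, pow_mul']
    have hprod : (q ^ k + 1) * (q ^ k - 1) = 2 ^ i := by
      rw [← Nat.sq_sub_sq, one_pow, ← hkk]; omega
    obtain ⟨s, -, hs⟩ := (Nat.dvd_prime_pow Nat.prime_two).1 (Dvd.intro _ hprod)
    obtain ⟨r, -, hr⟩ := (Nat.dvd_prime_pow Nat.prime_two).1 (Dvd.intro_left _ hprod)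
    have hs2 : 2 ≤ s := by
      by_contra hs2
      interval_cases s <;> omega
    have h4s : 4 ∣ q ^ k + 1 := by rw [hs]; exact h4 s hs2
    have hr1 : r ≤ 1 := by
      by_contra hr1
      have : 4 ∣ q ^ k - 1 := by rw [hr]; exact h4 r (by omega)
      omega
    have hx : q ^ k = 3 := by interval_cases r <;> omega
    have hk1 : k = 1 := by
      by_contra hk1
      have h9 : 3 ^ 2 ≤ q ^ k :=
        (Nat.pow_le_pow_left h3 2).trans (Nat.pow_le_pow_right (by omega) (by omega))
      omega
    subst hk1
    rw [pow_one] at hx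
    exact ⟨hx, hk⟩
  · -- odd exponent `j = 2k + 1`, `k ≥ 1`: lift along `q - 1 = 2 ^ t`
    exfalso
    obtain ⟨t, -, ht⟩ : ∃ t ≤ i, q - 1 = 2 ^ t := by
      refine (Nat.dvd_prime_pow Nat.prime_two).1 ?_
      rw [show 2 ^ i = q ^ j - 1 by omega]
      exact Nat.sub_one_dvd_pow_sub_one q j
    have hsq : q ^ 2 ≡ 1 [MOD 2 ^ (t + 1)] := by
      refine omegaTwo_sq_modEq (by omega) ?_
      rw [pow_succ, ht, mul_comm (q + 1)]
      exact mul_dvd_mul_left _ (hq.add_odd odd_one).two_dvd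
    have hmod : q ^ j ≡ q [MOD 2 ^ (t + 1)] := by
      rw [hk]
      exact omegaTwo_pow_odd_modEq hsq
    have hti : t < i := by
      have : 2 ^ t < 2 ^ i := by rw [← ht]; omega
      exact (Nat.pow_lt_pow_iff_right (by norm_num)).1 this
    have h1 : 2 ^ (t + 1) ∣ q ^ j - q := (Nat.modEq_iff_dvd' hql.le).1 hmod.symm
    have h2 : 2 ^ (t + 1) ∣ q ^ j - 1 := by
      rw [show q ^ j - 1 = 2 ^ i by omega]
      exact Nat.pow_dvd_pow 2 hti
    have htt : 2 ^ (t + 1) ∣ 2 ^ t := by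
      have := Nat.dvd_sub h2 h1
      rwa [show q ^ j - 1 - (q ^ j - q) = 2 ^ t by omega] at this
    have := (Nat.pow_dvd_pow_iff_le_right (by norm_num)).1 htt
    omega

/-! ## Consecutive numbers with at most two prime factors in total -/

/-- **The cell `ω(n(n+1)) ≤ 2`.** If `n ≥ 1` and `n(n+1)` has at most two distinct prime factors,
then `n + 1 < 2 · rad(n(n+1))`: either `n = 1`, or `n = p^i`, `n + 1 = q^j` are prime powers with
`2 ∈ {p, q}`, `rad(n(n+1)) = pq`, and by (A)/(B) the odd one of `n, n + 1` is a prime or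
`(n, n + 1) = (8, 9)`. [folklore] -/
theorem omegaTwo_consecutive {n : ℕ} (hn : 0 < n) (hcard : (n * (n + 1)).primeFactors.card ≤ 2) :
    n + 1 < 2 * radical (n * (n + 1)) := by
  rcases Nat.lt_or_ge 1 n with hn1 | hn1
  swap
  · obtain rfl : n = 1 := le_antisymm hn1 hn
    have h2 : 2 ≤ radical (1 * (1 + 1)) := Nat.two_le_radical_iff.2 (by norm_num)
    omega
  have hn0 : n ≠ 0 := by omega
  have hcop : Nat.Coprime n (n + 1) := Nat.coprime_self_add_right.2 (Nat.coprime_one_right n)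
  rw [Nat.primeFactors_mul hn0 n.succ_ne_zero,
    Finset.card_union_of_disjoint hcop.disjoint_primeFactors] at hcard
  have hc1 : 0 < n.primeFactors.card := Finset.card_pos.2 (Nat.nonempty_primeFactors.2 hn1)
  have hc2 : 0 < (n + 1).primeFactors.card :=
    Finset.card_pos.2 (Nat.nonempty_primeFactors.2 (by omega))
  obtain ⟨p, i, hp, hi, rfl⟩ := (isPrimePow_nat_iff n).1
    (isPrimePow_iff_card_primeFactors_eq_one.2 (by omega))
  obtain ⟨q, j, hq, hj, hqj⟩ := (isPrimePow_nat_iff (p ^ i + 1)).1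
    (isPrimePow_iff_card_primeFactors_eq_one.2 (by omega))
  -- the radical is `p * q`
  have hcop' : Nat.Coprime (p ^ i) (q ^ j) := by rwa [hqj]
  have hrad : radical (p ^ i * (p ^ i + 1)) = p * q := by
    rw [← hqj, UniqueFactorizationMonoid.radical_mul (Nat.coprime_iff_isRelPrime.1 hcop'),
      UniqueFactorizationMonoid.radical_pow_of_prime hp.prime hi.ne',
      UniqueFactorizationMonoid.radical_pow_of_prime hq.prime hj.ne', normalize_eq, normalize_eq]
  rw [hrad]
  -- one of `p, q` is `2`, the other one is odd
  have h2 : 2 ∣ p ^ i * q ^ j := by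
    rw [hqj]
    exact (Nat.even_mul_succ_self _).two_dvd
  have h2i : 2 ∣ 2 ^ i := dvd_pow_self 2 hi.ne'
  have h2j : 2 ∣ 2 ^ j := dvd_pow_self 2 hj.ne'
  rcases (Nat.Prime.dvd_mul Nat.prime_two).1 h2 with h2p | h2q
  · -- `p = 2`: `2 ^ i + 1 = q ^ j` with `q` odd, case (B)
    obtain rfl : 2 = p :=
      (Nat.prime_dvd_prime_iff_eq Nat.prime_two hp).1 (Nat.prime_two.dvd_of_dvd_pow h2p)
    have hq2 : q ≠ 2 := by
      rintro rfl
      omega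
    have hq3 : 3 ≤ q := by
      have := hq.two_le
      omega
    rcases omegaTwo_two_pow_add_one_eq_pow (hq.eq_two_or_odd'.resolve_left hq2) hq3 hqj.symm
      with hj1 | ⟨rfl, rfl⟩
    · obtain rfl : j = 1 := le_antisymm hj1 hj
      rw [pow_one] at hqj
      omega
    · omega
  · -- `q = 2`: `p ^ i + 1 = 2 ^ j` with `p` odd, case (A)
    obtain rfl : 2 = q :=
      (Nat.prime_dvd_prime_iff_eq Nat.prime_two hq).1 (Nat.prime_two.dvd_of_dvd_pow h2q)
    have hp2 : p ≠ 2 := by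
      rintro rfl
      omega
    have hp3 : 3 ≤ p := by
      have := hp.two_le
      omega
    obtain rfl : i = 1 := le_antisymm
      (omegaTwo_pow_add_one_eq_two_pow (hp.eq_two_or_odd'.resolve_left hp2) hp3 hqj.symm) hi
    rw [pow_one] at hqj ⊢
    omega

/-- **The cell `ω(abc) ≤ 2` of abc triples, integer form: `c < 2 · rad(abc)`.** One of `a, b` is
`1` (three pairwise coprime numbers `≥ 2` carry three primes), and then `omegaTwo_consecutive`
applies to `abc = n(n+1)`. [folklore] -/
theorem omegaTwo_triple {a b c : ℕ} (ha : 0 < a) (hb : 0 < b) (hsum : a + b = c)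
    (hcop : Nat.Coprime a b) (hcard : (a * b * c).primeFactors.card ≤ 2) : c < 2 * rad a b c := by
  rw [rad_def]
  rcases Nat.lt_or_ge 1 a with ha1 | ha1
  · rcases Nat.lt_or_ge 1 b with hb1 | hb1
    · -- `a, b ≥ 2`: three pairwise coprime numbers `≥ 2` have at least three prime factors
      exfalso
      have hc0 : c ≠ 0 := by omega
      have hac : Nat.Coprime a c := by
        rw [← hsum]
        exact Nat.coprime_self_add_right.mpr hcop
      have hbc : Nat.Coprime b c := by
        rw [← hsum]
        exact Nat.coprime_add_self_right.mpr hcop.symm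
      rw [Nat.primeFactors_mul (mul_ne_zero ha.ne' hb.ne') hc0, Nat.primeFactors_mul ha.ne' hb.ne',
        Finset.card_union_of_disjoint (Finset.disjoint_union_left.2
          ⟨hac.disjoint_primeFactors, hbc.disjoint_primeFactors⟩),
        Finset.card_union_of_disjoint hcop.disjoint_primeFactors] at hcard
      have h1 : 0 < a.primeFactors.card := Finset.card_pos.2 (Nat.nonempty_primeFactors.2 ha1)
      have h2 : 0 < b.primeFactors.card := Finset.card_pos.2 (Nat.nonempty_primeFactors.2 hb1)
      have h3 : 0 < c.primeFactors.card :=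
        Finset.card_pos.2 (Nat.nonempty_primeFactors.2 (by omega))
      omega
    · -- `b = 1`: `abc = a(a+1)`
      obtain rfl : b = 1 := le_antisymm hb1 hb
      subst hsum
      rw [mul_one] at hcard ⊢
      exact omegaTwo_consecutive ha hcard
  · -- `a = 1`: `abc = b(b+1)`
    obtain rfl : a = 1 := le_antisymm ha1 ha
    subst hsum
    rw [one_mul, Nat.add_comm 1 b] at hcard ⊢
    exact omegaTwo_consecutive hb hcard

/-! ## The stub -/

/-- **stub_omegaCounted_two (the elementary `S`-unit corner).** abc with `C = C(ε)` on the cell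
`ω(abc) ≤ 2`: such a triple is `1 + 1 = 2`, `(1, q, q + 1 = 2^n)`, `(1, 2^m, 2^m + 1 = r)` with
`q, r` prime, or `1 + 8 = 9`, and in each case `c < 2 · rad(abc) ≤ 2 · rad(abc)^(1+ε)`; so `C = 2`
serves for every `ε > 0`. [folklore] -/
theorem stub_omegaCounted_two :
    ∀ ε : ℝ, 0 < ε → ∃ C : ℝ, 0 < C ∧ ∀ a b c : ℕ, IsABCTriple a b c →
      (a * b * c).primeFactors.card ≤ 2 → (c : ℝ) < C * ((rad a b c : ℕ) : ℝ) ^ (1 + ε) := by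
  intro ε hε
  refine ⟨2, two_pos, fun a b c habc hcard => ?_⟩
  obtain ⟨ha, hb, hsum, hcop⟩ := habc
  have hkey : c < 2 * rad a b c := omegaTwo_triple ha hb hsum hcop hcard
  have hR : (1 : ℝ) ≤ ((rad a b c : ℕ) : ℝ) := by
    rw [rad_def]
    exact_mod_cast Nat.radical_pos _
  calc (c : ℝ) < ((2 * rad a b c : ℕ) : ℝ) := by exact_mod_cast hkey
    _ = 2 * ((rad a b c : ℕ) : ℝ) := by push_cast; ring
    _ ≤ 2 * ((rad a b c : ℕ) : ℝ) ^ (1 + ε) := by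
      gcongr
      exact Real.self_le_rpow_of_one_le hR (by linarith)

end Summit.ABC.ABC.Theorems.UniformSadicTowerFour.MixedRadical
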